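import Summits.KontsevichZagierPeriods.KontsevichZagierPeriods.Theorems.HurwitzMicroSectorsHurwitzSectorComplementGoldenTwistOfPTS
import Summits.KontsevichZagierPeriods.KontsevichZagierPeriods.Theorems.HurwitzMicroSectorsHurwitzSectorComplementParityTowerSector

/-!
# `HurwitzSectorComplement` (stmt-KontsevichZagierPeriods-14341), line `chebyshev-level-deformation`:
# the golden twist, unconditionally

`GoldenTwistInstance` of the crux ideation (SketchIdeator2 §2, `box 2` unfolded): the `ℚ`-rational
representations `[(0,1)² × (0, sin²(π/5)), 25(1+t³)/(1−t⁵)]` and `[(0,1)², 6/(1−xy)]` (both of value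
`π²`; the Galois relation `(5−√5)(ζ(2,⅕)+ζ(2,⅘)) = 8π²`, which no distribution relation reaches) ARE
KZ-equivalent — from the landed sector theorem `parityTowerSector` and the landed reduction
`goldenTwistInstance_of_parityTowerSector`. Reference: M. Kontsevich, D. Zagier, *Periods* (2001), §1.2.
-/

noncomputable section

open Set MeasureTheory
open scoped BigOperators
open Literature.NumberTheory.Transcendental

namespace Summit.KontsevichZagierPeriods.Theorems.HurwitzMicroSectorsHurwitzSectorComplement

/-- **The golden twist** (`GoldenTwistInstance`, SketchIdeator2 §2): the three-dimensional rational
representation `[(0,1)² × (0, sin²(π/5)), 25(1+t³)/(1−t⁵)]` and `[(0,1)², 6/(1−xy)]` are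
KZ-equivalent. [cite: KontsevichZagier2001, §1.2 Conjecture 1] -/
theorem goldenTwistInstance : ∀ (r : KZ.IntegralRep 3) (r' : KZ.IntegralRep 2), r.domain = {x | x 0 ∈ Set.Ioo (0:ℝ) 1 ∧ x 1 ∈ Set.Ioo (0:ℝ) 1 ∧ 0 < x 2 ∧ 8 * x 2 < 5 ∧ 5 < (8 * x 2 - 5) ^ 2} → Set.EqOn r.integrand (fun x => 25 * (1 + (x 0 * x 1) ^ 3) / (1 - (x 0 * x 1) ^ 5)) r.domain → r'.domain = {x | ∀ i, x i ∈ Set.Ioo (0:ℝ) 1} → Set.EqOn r'.integrand (fun x => 6 / (1 - x 0 * x 1)) r'.domain → KZ.Equivalent r r' :=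
  goldenTwistInstance_of_parityTowerSector parityTowerSector

end Summit.KontsevichZagierPeriods.Theorems.HurwitzMicroSectorsHurwitzSectorComplement

end
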